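import Summits.NavierStokesRegularity.FunctionalMining.NonlinearPoincareHolderMap
import HarnessLib

/-!
# FunctionalMining — the smooth regularisation `W_ε = (‖u‖² + ε)^{a/2} u` at a real parameter

Search for candidate a priori estimates; no regularity claim. Cell `pub-nsfunc`, prove seat
(gen 9). Static calculus lemmas on `T^d`, nothing about Navier–Stokes: the tools behind the
nonlinear Poincaré inequality at a REAL parameter `0 < a ≤ 2` (sequel `NonlinearPoincareRpow`)
and the top Lebesgue node of the vorticity-moment laws `Z_q`, `q = 2a + 2` (SIEVELD §3.1–3.2):
continuity of parametric integrals `ε ↦ ∫F(ε,x)dx` (used to pass to `ε → 0⁺`), smoothness of the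
radial weight `(‖u‖²+ε)^r` for `ε > 0`, the derivative bound
`‖∂ₖW_ε‖ ≤ (1+a)(‖u‖²+ε)^{a/2}‖∂ₖu‖`, `gradNormSq W_ε ≤ (1+a)²∫(‖u‖²+ε)^a∑ₖ‖∂ₖu‖²`, and
`‖W_ε − ‖u‖^a u‖ ≤ ε^{a/2}‖u‖` (`a ≤ 2`). Cases `a = 1, 2` are the tree's
`VelocityL4NonlinearPoincare` / `VelocityL6NonlinearPoincare` regularisations.

## Main statements

* `continuous_integral_param`, `le_of_forall_pos_le_of_continuousAt` — the `ε → 0⁺` tools.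
* `isSmooth_regA`, `partialDeriv_rpow_normSq_add`, `norm_partialDeriv_regA_le`,
  `gradNormSq_regA_le`, `norm_regA_sub_le` — the regularisation.
-/

noncomputable section

open MeasureTheory Finset Set Filter
open scoped InnerProductSpace RealInnerProductSpace ContDiff Topology

namespace Summit.NavierStokesRegularity.FunctionalMining

open Literature.Analysis.FunctionSpaces Literature.Analysis.FunctionSpaces.Torus

namespace NonlinearPoincare

variable {d : Type*} [Fintype d] [DecidableEq d]

/-! ## 1. Parametric continuity -/

omit [DecidableEq d] in
/-- Continuity of `ε ↦ ∫_{T^d} F(ε, x) dx` for jointly continuous `F` (compact torus). [folklore] -/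
theorem continuous_integral_param {E' : Type*} [NormedAddCommGroup E'] [NormedSpace ℝ E']
    {F : ℝ → UnitAddTorus d → E'} (hF : Continuous (Function.uncurry F)) :
    Continuous fun ε => ∫ x, F ε x := by
  have h := continuous_parametric_integral_of_continuous (μ := volume) hF isCompact_univ
  simpa only [Measure.restrict_univ] using h

omit [DecidableEq d] in
/-- Passing to `ε → 0⁺` in an inequality `V ≤ φ ε` (`0 < ε ≤ 1`) with `φ` continuous at `0`.
[folklore] -/
theorem le_of_forall_pos_le_of_continuousAt {V : ℝ} {φ : ℝ → ℝ} (hφ : ContinuousAt φ 0)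
    (h : ∀ ε : ℝ, 0 < ε → ε ≤ 1 → V ≤ φ ε) : V ≤ φ 0 := by
  have ht : Tendsto φ (𝓝[>] 0) (𝓝 (φ 0)) := hφ.tendsto.mono_left nhdsWithin_le_nhds
  refine ge_of_tendsto ht ?_
  have hmem : Ioo (0 : ℝ) 1 ∈ 𝓝[>] (0 : ℝ) := Ioo_mem_nhdsGT one_pos
  filter_upwards [hmem] with ε hε using h ε hε.1 hε.2.le

/-! ## 2. The regularisation `W_ε = (‖u‖² + ε)^{a/2} u` -/

omit [DecidableEq d] in
/-- The radial weight `(‖u‖² + ε)^r` is smooth for `ε > 0`. [folklore] -/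
theorem isSmooth_rpow_normSq_add {u : UnitAddTorus d → EuclideanSpace ℝ d} (hu : IsSmooth u)
    {ε : ℝ} (hε : 0 < ε) (r : ℝ) : IsSmooth (fun x => (‖u x‖ ^ 2 + ε) ^ r) := by
  have hw : IsSmooth (fun x => ‖u x‖ ^ 2 + ε) := (hu.norm_sq).add (isSmooth_const (d := d) (c := ε))
  have hφ : ContDiffOn ℝ ∞ (fun s : ℝ => s ^ r) (Set.Ioi 0) := fun y hy =>
    (Real.contDiffAt_rpow_const_of_ne (p := r) (ne_of_gt hy)).contDiffWithinAt
  exact IsSmooth.comp_of_contDiffOn hφ hw fun x => by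
    show 0 < ‖u x‖ ^ 2 + ε
    positivity

omit [DecidableEq d] in
/-- `W_ε = (‖u‖² + ε)^r u` is smooth for `ε > 0`. [folklore] -/
theorem isSmooth_regA {u : UnitAddTorus d → EuclideanSpace ℝ d} (hu : IsSmooth u) {ε : ℝ}
    (hε : 0 < ε) (r : ℝ) : IsSmooth (fun x => (‖u x‖ ^ 2 + ε) ^ r • u x) :=
  (isSmooth_rpow_normSq_add hu hε r).smul' hu

/-- `∂ₖ(‖u‖² + ε)^r = r (‖u‖²+ε)^{r−1} · 2⟪u, ∂ₖu⟫`. [folklore] -/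
theorem partialDeriv_rpow_normSq_add {u : UnitAddTorus d → EuclideanSpace ℝ d} (hu : IsSmooth u)
    {ε : ℝ} (hε : 0 < ε) (r : ℝ) (k : d) (x : UnitAddTorus d) :
    partialDeriv k (fun y => (‖u y‖ ^ 2 + ε) ^ r) x =
      r * (‖u x‖ ^ 2 + ε) ^ (r - 1) * (2 * ⟪u x, partialDeriv k u x⟫) := by
  have hw : IsSmooth (fun y => ‖u y‖ ^ 2 + ε) := (hu.norm_sq).add (isSmooth_const (d := d) (c := ε))
  have hpos : ∀ y, 0 < ‖u y‖ ^ 2 + ε := fun y => by positivity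
  have hφ : ContDiffOn ℝ ∞ (fun s : ℝ => s ^ r) (Set.Ioi 0) := fun y hy =>
    (Real.contDiffAt_rpow_const_of_ne (p := r) (ne_of_gt hy)).contDiffWithinAt
  have h := partialDeriv_comp_of_contDiffOn hφ isOpen_Ioi hw (fun y => hpos y) k x
  have hderiv : deriv (fun s : ℝ => s ^ r) (‖u x‖ ^ 2 + ε) = r * (‖u x‖ ^ 2 + ε) ^ (r - 1) :=
    (Real.hasDerivAt_rpow_const (p := r) (Or.inl (hpos x).ne')).deriv
  change partialDeriv k (fun z => (fun s : ℝ => s ^ r) ((fun y => ‖u y‖ ^ 2 + ε) z)) x = _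
  rw [h, hderiv, VelocityL6.partialDeriv_normSq_add hu ε k x]

/-- **Derivative bound for the regularisation**: for `a ≥ 0`, `ε > 0`,
`‖∂ₖW_ε‖ ≤ (1 + a) (‖u‖² + ε)^{a/2} ‖∂ₖu‖`. [ours] -/
theorem norm_partialDeriv_regA_le {u : UnitAddTorus d → EuclideanSpace ℝ d} (hu : IsSmooth u)
    {a ε : ℝ} (ha : 0 ≤ a) (hε : 0 < ε) (k : d) (x : UnitAddTorus d) :
    ‖partialDeriv k (fun y => (‖u y‖ ^ 2 + ε) ^ (a / 2) • u y) x‖ ≤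
      (1 + a) * (‖u x‖ ^ 2 + ε) ^ (a / 2) * ‖partialDeriv k u x‖ := by
  have hθ : IsContDiff 1 (fun y => (‖u y‖ ^ 2 + ε) ^ (a / 2)) :=
    (isSmooth_rpow_normSq_add hu hε (a / 2)).isContDiff (by simp)
  have hu1 : IsContDiff 1 u := hu.isContDiff (by simp)
  rw [partialDeriv_smul hθ hu1, partialDeriv_rpow_normSq_add hu hε]
  obtain ⟨h, hh⟩ : ∃ h : ℝ, h = ‖u x‖ ^ 2 + ε := ⟨_, rfl⟩
  have hpos : 0 < h := by rw [hh]; positivity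
  rw [← hh]
  have h1 : ‖h ^ (a / 2) • partialDeriv k u x‖ = h ^ (a / 2) * ‖partialDeriv k u x‖ := by
    rw [norm_smul, Real.norm_of_nonneg (Real.rpow_nonneg hpos.le _)]
  -- `h^{a/2-1} ‖u‖² ≤ h^{a/2}`
  have hkey : h ^ (a / 2 - 1) * ‖u x‖ ^ 2 ≤ h ^ (a / 2) := by
    have hu2 : ‖u x‖ ^ 2 ≤ h := by rw [hh]; linarith
    calc h ^ (a / 2 - 1) * ‖u x‖ ^ 2 ≤ h ^ (a / 2 - 1) * h :=
          mul_le_mul_of_nonneg_left hu2 (Real.rpow_nonneg hpos.le _)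
      _ = h ^ (a / 2) := by
          calc h ^ (a / 2 - 1) * h = h ^ (a / 2 - 1) * h ^ (1 : ℝ) := by rw [Real.rpow_one]
            _ = h ^ (a / 2) := by rw [← Real.rpow_add hpos, sub_add_cancel]
  have h2 : ‖(a / 2 * h ^ (a / 2 - 1) * (2 * ⟪u x, partialDeriv k u x⟫)) • u x‖ ≤
      a * h ^ (a / 2) * ‖partialDeriv k u x‖ := by
    rw [norm_smul, Real.norm_eq_abs]
    have hcs : |⟪u x, partialDeriv k u x⟫| ≤ ‖u x‖ * ‖partialDeriv k u x‖ :=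
      abs_real_inner_le_norm _ _
    have hr0 : 0 ≤ h ^ (a / 2 - 1) := Real.rpow_nonneg hpos.le _
    calc |a / 2 * h ^ (a / 2 - 1) * (2 * ⟪u x, partialDeriv k u x⟫)| * ‖u x‖
        = a * h ^ (a / 2 - 1) * |⟪u x, partialDeriv k u x⟫| * ‖u x‖ := by
          rw [abs_mul, abs_mul, abs_mul, abs_of_nonneg (by positivity : (0 : ℝ) ≤ a / 2),
            abs_of_nonneg hr0, abs_of_pos (by norm_num : (0 : ℝ) < 2)]
          ring
      _ ≤ a * h ^ (a / 2 - 1) * (‖u x‖ * ‖partialDeriv k u x‖) * ‖u x‖ := by gcongr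
      _ = a * (h ^ (a / 2 - 1) * ‖u x‖ ^ 2) * ‖partialDeriv k u x‖ := by ring
      _ ≤ a * h ^ (a / 2) * ‖partialDeriv k u x‖ := by gcongr
  calc ‖h ^ (a / 2) • partialDeriv k u x +
        (a / 2 * h ^ (a / 2 - 1) * (2 * ⟪u x, partialDeriv k u x⟫)) • u x‖
      ≤ ‖h ^ (a / 2) • partialDeriv k u x‖ +
          ‖(a / 2 * h ^ (a / 2 - 1) * (2 * ⟪u x, partialDeriv k u x⟫)) • u x‖ := norm_add_le _ _
    _ ≤ h ^ (a / 2) * ‖partialDeriv k u x‖ + a * h ^ (a / 2) * ‖partialDeriv k u x‖ := by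
        rw [h1]; gcongr
    _ = (1 + a) * h ^ (a / 2) * ‖partialDeriv k u x‖ := by ring

/-- `gradNormSq W_ε ≤ (1+a)² ∫ (‖u‖² + ε)^a ∑ₖ‖∂ₖu‖²` for `a ≥ 0`, `ε > 0`. [ours] -/
theorem gradNormSq_regA_le {u : UnitAddTorus d → EuclideanSpace ℝ d} (hu : IsSmooth u)
    {a ε : ℝ} (ha : 0 ≤ a) (hε : 0 < ε) :
    gradNormSq (fun y => (‖u y‖ ^ 2 + ε) ^ (a / 2) • u y) ≤
      (1 + a) ^ 2 * ∫ x, (‖u x‖ ^ 2 + ε) ^ a * ∑ k, ‖partialDeriv k u x‖ ^ 2 := by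
  unfold gradNormSq
  have hW := isSmooth_regA hu hε (a / 2)
  have hpos : ∀ x, 0 < ‖u x‖ ^ 2 + ε := fun x => by positivity
  have hc1 : Continuous fun x =>
      ∑ k, ‖partialDeriv k (fun y => (‖u y‖ ^ 2 + ε) ^ (a / 2) • u y) x‖ ^ 2 :=
    continuous_finsetSum _ fun k _ => (hW.partialDeriv k).continuous.norm.pow 2
  have hc2 : Continuous fun x => (‖u x‖ ^ 2 + ε) ^ a * ∑ k, ‖partialDeriv k u x‖ ^ 2 :=
    (((hu.continuous.norm.pow 2).add continuous_const).rpow_const fun x => Or.inr ha).mul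
      (continuous_finsetSum _ fun k _ => (hu.partialDeriv k).continuous.norm.pow 2)
  rw [← integral_const_mul]
  refine integral_mono hc1.integrable_unitAddTorus (hc2.integrable_unitAddTorus.const_mul _)
    fun x => ?_
  simp only
  rw [Finset.mul_sum, Finset.mul_sum]
  refine Finset.sum_le_sum fun k _ => ?_
  have h := norm_partialDeriv_regA_le hu ha hε k x
  have h0 : 0 ≤ ‖partialDeriv k (fun y => (‖u y‖ ^ 2 + ε) ^ (a / 2) • u y) x‖ := norm_nonneg _
  have hsq : ((‖u x‖ ^ 2 + ε) ^ (a / 2)) ^ 2 = (‖u x‖ ^ 2 + ε) ^ a := by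
    rw [← Real.rpow_natCast, ← Real.rpow_mul (hpos x).le]; norm_num
  calc ‖partialDeriv k (fun y => (‖u y‖ ^ 2 + ε) ^ (a / 2) • u y) x‖ ^ 2
      ≤ ((1 + a) * (‖u x‖ ^ 2 + ε) ^ (a / 2) * ‖partialDeriv k u x‖) ^ 2 :=
        pow_le_pow_left₀ h0 h 2
    _ = (1 + a) ^ 2 * ((‖u x‖ ^ 2 + ε) ^ a * ‖partialDeriv k u x‖ ^ 2) := by
        rw [← hsq]; ring

omit [DecidableEq d] in
/-- `‖W_ε − W‖ ≤ ε^{a/2} ‖u‖` for `0 < a ≤ 2`, `ε > 0` (`t ↦ t^{a/2}` is subadditive). [ours] -/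
theorem norm_regA_sub_le {u : UnitAddTorus d → EuclideanSpace ℝ d} {a ε : ℝ} (ha : 0 < a)
    (ha2 : a ≤ 2) (hε : 0 < ε) (x : UnitAddTorus d) :
    ‖(‖u x‖ ^ 2 + ε) ^ (a / 2) • u x - ‖u x‖ ^ a • u x‖ ≤ ε ^ (a / 2) * ‖u x‖ := by
  have hn : 0 ≤ ‖u x‖ := norm_nonneg _
  have e1 : (‖u x‖ ^ 2) ^ (a / 2) = ‖u x‖ ^ a := by
    rw [← Real.rpow_natCast, ← Real.rpow_mul hn]
    congr 1
    push_cast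
    ring
  have hsub : (‖u x‖ ^ 2 + ε) ^ (a / 2) ≤ (‖u x‖ ^ 2) ^ (a / 2) + ε ^ (a / 2) :=
    Real.rpow_add_le_add_rpow (sq_nonneg _) hε.le (by positivity) (by linarith)
  have hmono : ‖u x‖ ^ a ≤ (‖u x‖ ^ 2 + ε) ^ (a / 2) := by
    rw [← e1]; exact Real.rpow_le_rpow (sq_nonneg _) (by linarith) (by positivity)
  rw [← sub_smul, norm_smul, Real.norm_of_nonneg (by linarith)]
  have : (‖u x‖ ^ 2 + ε) ^ (a / 2) - ‖u x‖ ^ a ≤ ε ^ (a / 2) := by rw [e1] at hsub; linarith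
  exact mul_le_mul_of_nonneg_right this hn

end NonlinearPoincare

end Summit.NavierStokesRegularity.FunctionalMining
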